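import Summits.Ventures.PercRepro.C025ProfilePLDSolidLiftArith

/-!
# THE RANK-5 UNIFORM MATROID U_{5,m} FOR EVERY m ≥ 9 FROM THE CASE m = 9 AND THREE PRESERVERS: THE ARITHMETIC (night-3 g32)

`proofs/NIGHT3-G32-MATCHING.md` §6.  The profile of `U_{5,m}`, `m ≥ 9`, is `T₀₅ + m·T₁₅ + C(m,2)·T₂₅ + C(m,3)·T₃₅ + C(m,4)·T₄₅ +
c_m·δ₅₅` (`sum_choose_min_five`, `c_m = Σ_{5 ≤ i ≤ m−5} C(m,i)`), `m ↦ c_m` non-decreasing.  With `m = 9 + k`: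
`24·(U_{5,m} − U_{5,9}) = 24k·q₅ + 12k(11+k)·q₅′ + 4k(95 + 18k + k²)·q₅″ + k(k³ + 22k² + 155k + 326)·T₄₅ + 24(c_m − c₉)·δ₅₅`
where `q₅ = T₁₅ + 3·T₂₅ + 5·T₃₅ + 7·T₄₅`, `q₅′ = T₂₅ + 2·T₃₅ + 3·T₄₅`, `q₅″ = T₃₅ + 2·T₄₅` (the joint-LP preservers of kit
j314645; `twentyfour_mul_choose_four`, `choose_two_nine`, `choose_three_nine`, `choose_four_nine`, `lift_alg_five`).  `T₄₅`
(`PLDClosure.coloop` after `shift11` four times) and `δ₅₅` (`shift11` five times) preserve PER-LAYER DOMINANCE (g29); `q₅`,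
`q₅′`, `q₅″` do at bounded rank (certificate tables); hence the lift `lift_instance_five` for `9 ≤ m`.  No `def`, no
`instance`, no notation.  Axioms: standard.
-/

namespace PercRepro

open Finset

namespace PLDFiveLift

variable {ι : Type}

/-- The uniform profile of `U_{5,m}`, `m ≥ 9`: eleven layers. -/
theorem sum_choose_min_five (m : ℕ) (hm : 9 ≤ m) (g : ℕ → ℕ → ℕ) :
    ∑ i ∈ range (m + 1), m.choose i * g (min i 5) (min (m - i) 5) =
      g 0 5 + m * g 1 5 + m.choose 2 * g 2 5 + m.choose 3 * g 3 5 + m.choose 4 * g 4 5 +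
        (∑ i ∈ Ico 5 (m - 4), m.choose i) * g 5 5 +
        m.choose 4 * g 5 4 + m.choose 3 * g 5 3 + m.choose 2 * g 5 2 + m * g 5 1 + g 5 0 := by
  obtain ⟨k, rfl⟩ : ∃ k, m = k + 9 := ⟨m - 9, by omega⟩
  rw [sum_range_succ, sum_range_succ, sum_range_succ, sum_range_succ, sum_range_succ, sum_range_succ',
    sum_range_succ', sum_range_succ', sum_range_succ', sum_range_succ']
  have hmid : ∀ i ∈ range k, (k + 9).choose (i + 1 + 1 + 1 + 1 + 1) * g (min (i + 1 + 1 + 1 + 1 + 1) 5)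
      (min (k + 9 - (i + 1 + 1 + 1 + 1 + 1)) 5) = (k + 9).choose (i + 1 + 1 + 1 + 1 + 1) * g 5 5 := by
    intro i hi
    rw [mem_range] at hi
    rw [show min (i + 1 + 1 + 1 + 1 + 1) 5 = 5 by omega,
      show min (k + 9 - (i + 1 + 1 + 1 + 1 + 1)) 5 = 5 by omega]
  rw [sum_congr rfl hmid, ← sum_mul, show k + 9 - 4 = k + 5 by omega, sum_Ico_eq_sum_range,
    show k + 5 - 5 = k by omega]
  have hc : ∑ i ∈ range k, (k + 9).choose (5 + i) = ∑ i ∈ range k, (k + 9).choose (i + 1 + 1 + 1 + 1 + 1) :=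
    sum_congr rfl fun i _ => by rw [show 5 + i = i + 1 + 1 + 1 + 1 + 1 by omega]
  have h1 : (k + 9).choose (0 + 1) = k + 9 := Nat.choose_one_right _
  have h2 : (k + 9).choose (k + 8) = k + 9 := Nat.choose_succ_self_right (k + 8)
  have h3 : (k + 9).choose (k + 7) = (k + 9).choose 2 := by
    rw [← Nat.choose_symm (by omega : 2 ≤ k + 9), show k + 9 - 2 = k + 7 by omega]
  have h4 : (k + 9).choose (k + 6) = (k + 9).choose 3 := by
    rw [← Nat.choose_symm (by omega : 3 ≤ k + 9), show k + 9 - 3 = k + 6 by omega]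
  have h5 : (k + 9).choose (k + 5) = (k + 9).choose 4 := by
    rw [← Nat.choose_symm (by omega : 4 ≤ k + 9), show k + 9 - 4 = k + 5 by omega]
  rw [hc, Nat.choose_zero_right, Nat.choose_self, h1, h2, h3, h4, h5]
  simp only [show min (0 + 1) 5 = 1 by omega, show min (k + 8) 5 = 5 by omega, show min 0 5 = 0 by omega,
    show k + 9 - 0 = k + 9 by omega, show min (k + 9) 5 = 5 by omega, show k + 9 - (k + 8) = 1 by omega,
    show k + 9 - (k + 9) = 0 by omega, show min (0 + 1 + 1) 5 = 2 by omega, show min (k + 7) 5 = 5 by omega,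
    show k + 9 - (k + 7) = 2 by omega, show min (0 + 1 + 1 + 1) 5 = 3 by omega, show min (k + 6) 5 = 5 by omega,
    show k + 9 - (k + 6) = 3 by omega, show min (0 + 1 + 1 + 1 + 1) 5 = 4 by omega,
    show min (k + 5) 5 = 5 by omega, show k + 9 - (k + 5) = 4 by omega,
    show min (k + 9 - (0 + 1)) 5 = 5 by omega, show min (k + 9 - (0 + 1 + 1)) 5 = 5 by omega,
    show min (k + 9 - (0 + 1 + 1 + 1)) 5 = 5 by omega, one_mul]
  ring

/-- `c_{m₀} ≤ c_m` for `m₀ ≤ m`. -/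
theorem sum_choose_mid5_mono (m₀ m : ℕ) (hm : m₀ ≤ m) :
    ∑ i ∈ Ico 5 (m₀ - 4), m₀.choose i ≤ ∑ i ∈ Ico 5 (m - 4), m.choose i := by
  calc ∑ i ∈ Ico 5 (m₀ - 4), m₀.choose i ≤ ∑ i ∈ Ico 5 (m₀ - 4), m.choose i :=
        sum_le_sum fun i _ => Nat.choose_le_choose i hm
    _ ≤ ∑ i ∈ Ico 5 (m - 4), m.choose i :=
        sum_le_sum_of_subset_of_nonneg (Ico_subset_Ico le_rfl (by omega)) fun _ _ _ => Nat.zero_le _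

/-- `24·C(m,4) = m·(m−1)·(m−2)·(m−3)`. -/
theorem twentyfour_mul_choose_four (m : ℕ) : 24 * m.choose 4 = m * (m - 1) * (m - 2) * (m - 3) := by
  rcases m with _ | n
  · rfl
  · have h := Nat.add_one_mul_choose_eq n 3
    have h3 := PLDSolidLift.six_mul_choose_three n
    calc 24 * (n + 1).choose 4 = 6 * ((n + 1).choose (3 + 1) * (3 + 1)) := by ring
      _ = 6 * ((n + 1) * n.choose 3) := by rw [h]
      _ = (n + 1) * (6 * n.choose 3) := by ring
      _ = (n + 1) * (n * (n - 1) * (n - 2)) := by rw [h3]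
      _ = (n + 1) * (n + 1 - 1) * (n + 1 - 2) * (n + 1 - 3) := by
        rcases n with _ | n
        · rfl
        · rcases n with _ | n
          · rfl
          · rw [show n + 1 + 1 + 1 - 1 = n + 2 by omega, show n + 1 + 1 + 1 - 2 = n + 1 by omega,
              show n + 1 + 1 + 1 - 3 = n by omega, show n + 1 + 1 - 1 = n + 1 by omega,
              show n + 1 + 1 - 2 = n by omega]
            ring

/-- `24·C(9+k, 2) = 864 + 204k + 12k²`. -/
theorem choose_two_nine (k : ℕ) : 24 * (9 + k).choose 2 = 864 + 204 * k + 12 * k * k := by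
  have h := PLDSolidLift.two_mul_choose_two (9 + k)
  rw [show 9 + k - 1 = 8 + k by omega] at h
  nlinarith [h]

/-- `24·C(9+k, 3) = 2016 + 764k + 96k² + 4k³`. -/
theorem choose_three_nine (k : ℕ) :
    24 * (9 + k).choose 3 = 2016 + 764 * k + 96 * k * k + 4 * k * k * k := by
  have h := PLDSolidLift.six_mul_choose_three (9 + k)
  rw [show 9 + k - 1 = 8 + k by omega, show 9 + k - 2 = 7 + k by omega] at h
  nlinarith [h]

/-- `24·C(9+k, 4) = 3024 + 1650k + 335k² + 30k³ + k⁴`. -/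
theorem choose_four_nine (k : ℕ) :
    24 * (9 + k).choose 4 = 3024 + 1650 * k + 335 * k * k + 30 * k * k * k + k * k * k * k := by
  have h := twentyfour_mul_choose_four (9 + k)
  rw [show 9 + k - 1 = 8 + k by omega, show 9 + k - 2 = 7 + k by omega, show 9 + k - 3 = 6 + k by omega] at h
  nlinarith [h]

/-- The linear algebra of the rank-5 lift from `m₀ = 9`, with the twenty-two layer sums and the coefficients abstracted
(`C₂ = C(9+k, 2)`, `C₃ = C(9+k, 3)`, `C₄ = C(9+k, 4)`). -/
theorem lift_alg_five (a05 a15 a25 a35 a45 a55 a54 a53 a52 a51 a50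
    b05 b15 b25 b35 b45 b55 b54 b53 b52 b51 b50 k k' C2 C3 C4 c₀ : ℕ)
    (hC2 : 24 * C2 = 864 + 204 * k + 12 * k * k)
    (hC3 : 24 * C3 = 2016 + 764 * k + 96 * k * k + 4 * k * k * k)
    (hC4 : 24 * C4 = 3024 + 1650 * k + 335 * k * k + 30 * k * k * k + k * k * k * k)
    (h₀ : a05 + 9 * a15 + 36 * a25 + 84 * a35 + 126 * a45 + c₀ * a55 + 126 * a54 + 84 * a53 + 36 * a52 + 9 * a51 + a50 ≤
      b05 + 9 * b15 + 36 * b25 + 84 * b35 + 126 * b45 + c₀ * b55 + 126 * b54 + 84 * b53 + 36 * b52 + 9 * b51 + b50)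
    (hq : (a15 + a51) + 3 * (a25 + a52) + 5 * (a35 + a53) + 7 * (a45 + a54) ≤
      (b15 + b51) + 3 * (b25 + b52) + 5 * (b35 + b53) + 7 * (b45 + b54))
    (hq' : (a25 + a52) + 2 * (a35 + a53) + 3 * (a45 + a54) ≤ (b25 + b52) + 2 * (b35 + b53) + 3 * (b45 + b54))
    (hq'' : (a35 + a53) + 2 * (a45 + a54) ≤ (b35 + b53) + 2 * (b45 + b54))
    (hT : a45 + a54 ≤ b45 + b54) (hS : a55 ≤ b55) :
    a05 + (9 + k) * a15 + C2 * a25 + C3 * a35 + C4 * a45 + (c₀ + k') * a55 + C4 * a54 + C3 * a53 + C2 * a52 +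
        (9 + k) * a51 + a50 ≤
      b05 + (9 + k) * b15 + C2 * b25 + C3 * b35 + C4 * b45 + (c₀ + k') * b55 + C4 * b54 + C3 * b53 + C2 * b52 +
        (9 + k) * b51 + b50 := by
  have e1 : 24 * C2 * a25 = (864 + 204 * k + 12 * k * k) * a25 := by rw [hC2]
  have e2 : 24 * C2 * a52 = (864 + 204 * k + 12 * k * k) * a52 := by rw [hC2]
  have e3 : 24 * C2 * b25 = (864 + 204 * k + 12 * k * k) * b25 := by rw [hC2]
  have e4 : 24 * C2 * b52 = (864 + 204 * k + 12 * k * k) * b52 := by rw [hC2]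
  have f1 : 24 * C3 * a35 = (2016 + 764 * k + 96 * k * k + 4 * k * k * k) * a35 := by rw [hC3]
  have f2 : 24 * C3 * a53 = (2016 + 764 * k + 96 * k * k + 4 * k * k * k) * a53 := by rw [hC3]
  have f3 : 24 * C3 * b35 = (2016 + 764 * k + 96 * k * k + 4 * k * k * k) * b35 := by rw [hC3]
  have f4 : 24 * C3 * b53 = (2016 + 764 * k + 96 * k * k + 4 * k * k * k) * b53 := by rw [hC3]
  have g1 : 24 * C4 * a45 = (3024 + 1650 * k + 335 * k * k + 30 * k * k * k + k * k * k * k) * a45 := by rw [hC4]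
  have g2 : 24 * C4 * a54 = (3024 + 1650 * k + 335 * k * k + 30 * k * k * k + k * k * k * k) * a54 := by rw [hC4]
  have g3 : 24 * C4 * b45 = (3024 + 1650 * k + 335 * k * k + 30 * k * k * k + k * k * k * k) * b45 := by rw [hC4]
  have g4 : 24 * C4 * b54 = (3024 + 1650 * k + 335 * k * k + 30 * k * k * k + k * k * k * k) * b54 := by rw [hC4]
  have hqk := Nat.mul_le_mul_left (24 * k) hq
  have hq'k := Nat.mul_le_mul_left (12 * k * (11 + k)) hq'
  have hq''k := Nat.mul_le_mul_left (4 * k * (95 + 18 * k + k * k)) hq''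
  have hTk := Nat.mul_le_mul_left (k * (k * k * k + 22 * k * k + 155 * k + 326)) hT
  have hSk := Nat.mul_le_mul_left (24 * k') hS
  linarith [e1, e2, e3, e4, f1, f2, f3, f4, g1, g2, g3, g4, hqk, hq'k, hq''k, hTk, hSk, h₀]

/-- THE LIFT IN `m` FOR `U_{5,m}` from `m₀ = 9`: for a family `(s, x, f)` with (PLD), `9 ≤ m`, an admissible `(lo, hi, δ, Θ)`,
the `q₅`-, `q₅′`-, `q₅″`-instances and the `U_{5,9}`-instance give the `U_{5,m}`-instance. -/
theorem lift_instance_five (s : Finset ι) (x f : ι → ℕ)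
    (hPLD : ∀ lo hi δ Θ : ℕ, Θ ≤ lo + hi + δ → (lo = 0 ∨ lo + hi + δ ≤ Θ) →
      ∑ i ∈ s, (if lo ≤ x i ∧ x i ≤ hi ∧ Θ ≤ f i + x i then (f i).choose δ else 0) ≤
        ∑ i ∈ s, (if lo + δ ≤ f i ∧ f i ≤ hi + δ then (f i).choose δ else 0))
    (m : ℕ) (hm : 9 ≤ m) (lo hi δ Θ : ℕ) (hΘ : Θ ≤ lo + hi + δ) (hlo : lo = 0 ∨ lo + hi + δ ≤ Θ)
    (hq : ∑ i ∈ s, (((if lo ≤ x i + 1 ∧ x i + 1 ≤ hi ∧ Θ ≤ (f i + 5) + (x i + 1) then (f i + 5).choose δ else 0) + (if lo ≤ x i + 5 ∧ x i + 5 ≤ hi ∧ Θ ≤ (f i + 1) + (x i + 5) then (f i + 1).choose δ else 0)) + 3 * ((if lo ≤ x i + 2 ∧ x i + 2 ≤ hi ∧ Θ ≤ (f i + 5) + (x i + 2) then (f i + 5).choose δ else 0) + (if lo ≤ x i + 5 ∧ x i + 5 ≤ hi ∧ Θ ≤ (f i + 2) + (x i + 5) then (f i + 2).choose δ else 0)) +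 5 * ((if lo ≤ x i + 3 ∧ x i + 3 ≤ hi ∧ Θ ≤ (f i + 5) + (x i + 3) then (f i + 5).choose δ else 0) + (if lo ≤ x i + 5 ∧ x i + 5 ≤ hi ∧ Θ ≤ (f i + 3) + (x i + 5) then (f i + 3).choose δ else 0)) + 7 * ((if lo ≤ x i + 4 ∧ x i + 4 ≤ hi ∧ Θ ≤ (f i + 5) + (x i + 4) then (f i + 5).choose δ else 0) + (if lo ≤ x i + 5 ∧ x i + 5 ≤ hi ∧ Θ ≤ (f i + 4) + (x i + 5) then (f i + 4).choose δ else 0))) ≤ ∑ i ∈ s, (((if lo + δ ≤ f i + 5 ∧ f i + 5 ≤ hi + δ then (f i + 5).choose δ else 0) + (if lo + δ ≤ f i + 1 ∧ f i + 1 ≤ hi + δ then (f i + 1).choose δ else 0)) + 3 * ((if lo + δ ≤ f i + 5 ∧ f i + 5 ≤ hi + δ then (f i + 5).choose δ else 0) + (if lo + δ ≤ f i + 2 ∧ f i + 2 ≤ hi + δ then (f i + 2).choose δ else 0)) + 5 * ((if lo + δ ≤ f i + 5 ∧ f i + 5 ≤ hi + δ then (f i + 5).choose δ else 0) + (if lo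 + δ ≤ f i + 3 ∧ f i + 3 ≤ hi + δ then (f i + 3).choose δ else 0)) + 7 * ((if lo + δ ≤ f i + 5 ∧ f i + 5 ≤ hi + δ then (f i + 5).choose δ else 0) + (if lo + δ ≤ f i + 4 ∧ f i + 4 ≤ hi + δ then (f i + 4).choose δ else 0))))
    (hq' : ∑ i ∈ s, (((if lo ≤ x i + 2 ∧ x i + 2 ≤ hi ∧ Θ ≤ (f i + 5) + (x i + 2) then (f i + 5).choose δ else 0) + (if lo ≤ x i + 5 ∧ x i + 5 ≤ hi ∧ Θ ≤ (f i + 2) + (x i + 5) then (f i + 2).choose δ else 0)) + 2 * ((if lo ≤ x i + 3 ∧ x i + 3 ≤ hi ∧ Θ ≤ (f i + 5) + (x i + 3) then (f i + 5).choose δ else 0) + (if lo ≤ x i + 5 ∧ x i + 5 ≤ hi ∧ Θ ≤ (f i + 3) + (x i + 5) then (f i + 3).choose δ else 0)) + 3 * ((if lo ≤ x i + 4 ∧ x i + 4 ≤ hi ∧ Θ ≤ (f i + 5) + (x i + 4) then (f i + 5).choose δ else 0) + (if lo ≤ x i + 5 ∧ x i + 5 ≤ hi ∧ Θ ≤ (f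 i + 4) + (x i + 5) then (f i + 4).choose δ else 0))) ≤ ∑ i ∈ s, (((if lo + δ ≤ f i + 5 ∧ f i + 5 ≤ hi + δ then (f i + 5).choose δ else 0) + (if lo + δ ≤ f i + 2 ∧ f i + 2 ≤ hi + δ then (f i + 2).choose δ else 0)) + 2 * ((if lo + δ ≤ f i + 5 ∧ f i + 5 ≤ hi + δ then (f i + 5).choose δ else 0) + (if lo + δ ≤ f i + 3 ∧ f i + 3 ≤ hi + δ then (f i + 3).choose δ else 0)) + 3 * ((if lo + δ ≤ f i + 5 ∧ f i + 5 ≤ hi + δ then (f i + 5).choose δ else 0) + (if lo + δ ≤ f i + 4 ∧ f i + 4 ≤ hi + δ then (f i + 4).choose δ else 0))))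
    (hq'' : ∑ i ∈ s, (((if lo ≤ x i + 3 ∧ x i + 3 ≤ hi ∧ Θ ≤ (f i + 5) + (x i + 3) then (f i + 5).choose δ else 0) + (if lo ≤ x i + 5 ∧ x i + 5 ≤ hi ∧ Θ ≤ (f i + 3) + (x i + 5) then (f i + 3).choose δ else 0)) + 2 * ((if lo ≤ x i + 4 ∧ x i + 4 ≤ hi ∧ Θ ≤ (f i + 5) + (x i + 4) then (f i + 5).choose δ else 0) + (if lo ≤ x i + 5 ∧ x i + 5 ≤ hi ∧ Θ ≤ (f i + 4) + (x i + 5) then (f i + 4).choose δ else 0))) ≤ ∑ i ∈ s, (((if lo + δ ≤ f i + 5 ∧ f i + 5 ≤ hi + δ then (f i + 5).choose δ else 0) + (if lo + δ ≤ f i + 3 ∧ f i + 3 ≤ hi + δ then (f i + 3).choose δ else 0)) + 2 * ((if lo + δ ≤ f i + 5 ∧ f i + 5 ≤ hi + δ then (f i + 5).choose δ else 0) + (if lo + δ ≤ f i + 4 ∧ f i + 4 ≤ hi + δ then (f i + 4).choose δ else 0))))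
    (h₀ : ∑ i ∈ s, ∑ j ∈ range (9 + 1), Nat.choose 9 j *
        (if lo ≤ x i + min j 5 ∧ x i + min j 5 ≤ hi ∧ Θ ≤ (f i + min (9 - j) 5) + (x i + min j 5) then
          (f i + min (9 - j) 5).choose δ else 0) ≤
      ∑ i ∈ s, ∑ j ∈ range (9 + 1), Nat.choose 9 j *
        (if lo + δ ≤ f i + min (9 - j) 5 ∧ f i + min (9 - j) 5 ≤ hi + δ then (f i + min (9 - j) 5).choose δ else 0)) :
    ∑ i ∈ s, ∑ j ∈ range (m + 1), Nat.choose m j *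
        (if lo ≤ x i + min j 5 ∧ x i + min j 5 ≤ hi ∧ Θ ≤ (f i + min (m - j) 5) + (x i + min j 5) then
          (f i + min (m - j) 5).choose δ else 0) ≤
      ∑ i ∈ s, ∑ j ∈ range (m + 1), Nat.choose m j *
        (if lo + δ ≤ f i + min (m - j) 5 ∧ f i + min (m - j) 5 ≤ hi + δ then (f i + min (m - j) 5).choose δ else 0) := by
  -- the preservers `T₄₅` and `δ₅₅`
  have h11 : ∀ lo hi δ Θ : ℕ, Θ ≤ lo + hi + δ → (lo = 0 ∨ lo + hi + δ ≤ Θ) →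
      ∑ i ∈ s, (if lo ≤ x i + 1 ∧ x i + 1 ≤ hi ∧ Θ ≤ (f i + 1) + (x i + 1) then (f i + 1).choose δ else 0) ≤
        ∑ i ∈ s, (if lo + δ ≤ f i + 1 ∧ f i + 1 ≤ hi + δ then (f i + 1).choose δ else 0) :=
    fun lo hi δ Θ h1 h2 => PLDClosure.shift11 s x f hPLD lo hi δ Θ h1 h2
  have h22 : ∀ lo hi δ Θ : ℕ, Θ ≤ lo + hi + δ → (lo = 0 ∨ lo + hi + δ ≤ Θ) →
      ∑ i ∈ s, (if lo ≤ x i + 2 ∧ x i + 2 ≤ hi ∧ Θ ≤ (f i + 2) + (x i + 2) then (f i + 2).choose δ else 0) ≤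
        ∑ i ∈ s, (if lo + δ ≤ f i + 2 ∧ f i + 2 ≤ hi + δ then (f i + 2).choose δ else 0) :=
    fun lo hi δ Θ h1 h2 => PLDClosure.shift11 s (fun i => x i + 1) (fun i => f i + 1) h11 lo hi δ Θ h1 h2
  have h33 : ∀ lo hi δ Θ : ℕ, Θ ≤ lo + hi + δ → (lo = 0 ∨ lo + hi + δ ≤ Θ) →
      ∑ i ∈ s, (if lo ≤ x i + 3 ∧ x i + 3 ≤ hi ∧ Θ ≤ (f i + 3) + (x i + 3) then (f i + 3).choose δ else 0) ≤
        ∑ i ∈ s, (if lo + δ ≤ f i + 3 ∧ f i + 3 ≤ hi + δ then (f i + 3).choose δ else 0) :=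
    fun lo hi δ Θ h1 h2 => PLDClosure.shift11 s (fun i => x i + 2) (fun i => f i + 2) h22 lo hi δ Θ h1 h2
  have h44 : ∀ lo hi δ Θ : ℕ, Θ ≤ lo + hi + δ → (lo = 0 ∨ lo + hi + δ ≤ Θ) →
      ∑ i ∈ s, (if lo ≤ x i + 4 ∧ x i + 4 ≤ hi ∧ Θ ≤ (f i + 4) + (x i + 4) then (f i + 4).choose δ else 0) ≤
        ∑ i ∈ s, (if lo + δ ≤ f i + 4 ∧ f i + 4 ≤ hi + δ then (f i + 4).choose δ else 0) :=
    fun lo hi δ Θ h1 h2 => PLDClosure.shift11 s (fun i => x i + 3) (fun i => f i + 3) h33 lo hi δ Θ h1 h2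
  have hT : ∑ i ∈ s, (((if lo ≤ x i + 4 ∧ x i + 4 ≤ hi ∧ Θ ≤ (f i + 5) + (x i + 4) then (f i + 5).choose δ else 0) + (if lo ≤ x i + 5 ∧ x i + 5 ≤ hi ∧ Θ ≤ (f i + 4) + (x i + 5) then (f i + 4).choose δ else 0))) ≤ ∑ i ∈ s, (((if lo + δ ≤ f i + 5 ∧ f i + 5 ≤ hi + δ then (f i + 5).choose δ else 0) + (if lo + δ ≤ f i + 4 ∧ f i + 4 ≤ hi + δ then (f i + 4).choose δ else 0))) :=
    PLDClosure.coloop s (fun i => x i + 4) (fun i => f i + 4) h44 lo hi δ Θ hΘ hlo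
  have hS : ∑ i ∈ s, (if lo ≤ x i + 5 ∧ x i + 5 ≤ hi ∧ Θ ≤ (f i + 5) + (x i + 5) then (f i + 5).choose δ else 0) ≤ ∑ i ∈ s, (if lo + δ ≤ f i + 5 ∧ f i + 5 ≤ hi + δ then (f i + 5).choose δ else 0) :=
    PLDClosure.shift11 s (fun i => x i + 4) (fun i => f i + 4) h44 lo hi δ Θ hΘ hlo
  -- the eleven layers, for `m` and for `9`
  have hLm : ∀ n : ℕ, 9 ≤ n → ∀ i ∈ s, ∑ j ∈ range (n + 1), Nat.choose n j *
        (if lo ≤ x i + min j 5 ∧ x i + min j 5 ≤ hi ∧ Θ ≤ (f i + min (n - j) 5) + (x i + min j 5) then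
          (f i + min (n - j) 5).choose δ else 0) =
      (if lo ≤ x i ∧ x i ≤ hi ∧ Θ ≤ (f i + 5) + (x i) then (f i + 5).choose δ else 0) + n * (if lo ≤ x i + 1 ∧ x i + 1 ≤ hi ∧ Θ ≤ (f i + 5) + (x i + 1) then (f i + 5).choose δ else 0) + n.choose 2 * (if lo ≤ x i + 2 ∧ x i + 2 ≤ hi ∧ Θ ≤ (f i + 5) + (x i + 2) then (f i + 5).choose δ else 0) + n.choose 3 * (if lo ≤ x i + 3 ∧ x i + 3 ≤ hi ∧ Θ ≤ (f i + 5) + (x i + 3) then (f i + 5).choose δ else 0) + n.choose 4 * (if lo ≤ x i + 4 ∧ x i + 4 ≤ hi ∧ Θ ≤ (f i + 5) + (x i + 4) then (f i + 5).choose δ else 0) + (∑ i ∈ Ico 5 (n - 4), n.choose i) * (if lo ≤ x i + 5 ∧ x i + 5 ≤ hi ∧ Θ ≤ (f i + 5) + (x i + 5) then (f i + 5).choose δ else 0) + n.choose 4 * (if lo ≤ x i + 5 ∧ x i + 5 ≤ hi ∧ Θ ≤ (f i + 4) + (x i + 5) then (f i + 4).choose δ else 0) + n.choose 3 * (if lo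 ≤ x i + 5 ∧ x i + 5 ≤ hi ∧ Θ ≤ (f i + 3) + (x i + 5) then (f i + 3).choose δ else 0) + n.choose 2 * (if lo ≤ x i + 5 ∧ x i + 5 ≤ hi ∧ Θ ≤ (f i + 2) + (x i + 5) then (f i + 2).choose δ else 0) + n * (if lo ≤ x i + 5 ∧ x i + 5 ≤ hi ∧ Θ ≤ (f i + 1) + (x i + 5) then (f i + 1).choose δ else 0) + (if lo ≤ x i + 5 ∧ x i + 5 ≤ hi ∧ Θ ≤ f i + (x i + 5) then (f i).choose δ else 0) :=
    fun n hn i _ => sum_choose_min_five n hn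
      (fun a b => if lo ≤ x i + a ∧ x i + a ≤ hi ∧ Θ ≤ (f i + b) + (x i + a) then (f i + b).choose δ else 0)
  have hRm : ∀ n : ℕ, 9 ≤ n → ∀ i ∈ s, ∑ j ∈ range (n + 1), Nat.choose n j *
        (if lo + δ ≤ f i + min (n - j) 5 ∧ f i + min (n - j) 5 ≤ hi + δ then (f i + min (n - j) 5).choose δ else 0) =
      (if lo + δ ≤ f i + 5 ∧ f i + 5 ≤ hi + δ then (f i + 5).choose δ else 0) + n * (if lo + δ ≤ f i + 5 ∧ f i + 5 ≤ hi + δ then (f i + 5).choose δ else 0) + n.choose 2 * (if lo + δ ≤ f i + 5 ∧ f i + 5 ≤ hi + δ then (f i + 5).choose δ else 0) + n.choose 3 * (if lo + δ ≤ f i + 5 ∧ f i + 5 ≤ hi + δ then (f i + 5).choose δ else 0) + n.choose 4 * (if lo + δ ≤ f i + 5 ∧ f i + 5 ≤ hi + δ then (f i + 5).choose δ else 0) + (∑ i ∈ Ico 5 (n - 4), n.choose i) * (if lo + δ ≤ f i + 5 ∧ f i + 5 ≤ hi + δ then (f i + 5).choose δ else 0) + n.choose 4 * (if lo + δ ≤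 f i + 4 ∧ f i + 4 ≤ hi + δ then (f i + 4).choose δ else 0) + n.choose 3 * (if lo + δ ≤ f i + 3 ∧ f i + 3 ≤ hi + δ then (f i + 3).choose δ else 0) + n.choose 2 * (if lo + δ ≤ f i + 2 ∧ f i + 2 ≤ hi + δ then (f i + 2).choose δ else 0) + n * (if lo + δ ≤ f i + 1 ∧ f i + 1 ≤ hi + δ then (f i + 1).choose δ else 0) + (if lo + δ ≤ f i ∧ f i ≤ hi + δ then (f i).choose δ else 0) :=
    fun n hn i _ => sum_choose_min_five n hn
      (fun _ b => if lo + δ ≤ f i + b ∧ f i + b ≤ hi + δ then (f i + b).choose δ else 0)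
  rw [sum_congr rfl (hLm m hm), sum_congr rfl (hRm m hm)]
  rw [sum_congr rfl (hLm 9 le_rfl), sum_congr rfl (hRm 9 le_rfl)] at h₀
  simp only [sum_add_distrib, ← mul_sum] at h₀ hq hq' hq'' ⊢
  rw [sum_add_distrib, sum_add_distrib] at hT
  -- the coefficients
  obtain ⟨k, hk⟩ := Nat.exists_eq_add_of_le hm
  obtain ⟨k', hk'⟩ := Nat.exists_eq_add_of_le (sum_choose_mid5_mono 9 m hm)
  have hC2 : 24 * m.choose 2 = 864 + 204 * k + 12 * k * k := by rw [hk]; exact choose_two_nine k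
  have hC3 : 24 * m.choose 3 = 2016 + 764 * k + 96 * k * k + 4 * k * k * k := by rw [hk]; exact choose_three_nine k
  have hC4 : 24 * m.choose 4 = 3024 + 1650 * k + 335 * k * k + 30 * k * k * k + k * k * k * k := by
    rw [hk]; exact choose_four_nine k
  have h9c2 : Nat.choose 9 2 = 36 := by decide
  have h9c3 : Nat.choose 9 3 = 84 := by decide
  have h9c4 : Nat.choose 9 4 = 126 := by decide
  rw [h9c2, h9c3, h9c4] at h₀
  rw [hk']
  rw [hk] at hC2 hC3 hC4 ⊢
  exact lift_alg_five _ _ _ _ _ _ _ _ _ _ _ _ _ _ _ _ _ _ _ _ _ _ _ _ _ _ _ _ hC2 hC3 hC4 h₀ hq hq' hq'' hT hS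

end PLDFiveLift

end PercRepro
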